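import Literature.Analysis.FluidPDE.LerayHopfClassicalContinuation

/-!
# Continuation of a bounded classical representative of a Leray–Hopf solution up to a prescribed
# time, under an a-priori bound

Analysis/FluidPDE **proofs file** (theorems only: no definitions, no named facts, no `sorry`).
Companion of `LerayHopfClassicalContinuation.lean`, whose
`exists_classical_extension_of_bounded_rep` continues a BOUNDED classical representative `(V, P)`
on `[0, β)` of a Leray–Hopf weak solution `u` on `ℝ³ × [0, T)` strictly past `β`. Here that step
is driven to a PRESCRIBED end `β₁ < T` under an A-PRIORI bound (Robinson–Rodrigo–Sadowski 2016,
Thm. 8.17 in the Serrin class `L²(0, T; L^∞)`: "blowup at time `T₁` is impossible" while the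
solution stays bounded; Leray 1934, §33: a regular solution does not become irregular while
`max |u|` stays finite): if EVERY classical representative of `u` on a time set `[0, β)`,
`β₀ ≤ β ≤ β₁`, continuing the given one is bounded by `M` on `[0, β) × ℝ³`, then the given
representative continues, as a classical representative of `u`, strictly past `β₁`
(`exists_classical_extension_of_apriori_bound`).

Proof ("the maximal time of classical existence inside an `L^∞` envelope is not before the end
of the envelope"): the set of reachable ends `β ∈ [β₀, β₁]` is nonempty and bounded above;
classical representatives on nested time sets agree on the common part (a.e. equal to `u`,
continuous slices) and glue along a sequence of reachable ends increasing to the supremum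
(`IsClassicalNSSolutionOn.exists_glue_Ico_right`), so the supremum is reached; the representative
there is bounded by the a-priori hypothesis, hence continues strictly past it
(`exists_classical_extension_of_bounded_rep`) — so the supremum is `β₁`, and that last
continuation reaches past `β₁`. The point of keeping the Leray–Hopf solution in the statement: the
continuation is a.e. equal to `u`, so its slices carry the energy of `u` (a bare classical
extension, `HasSmoothExtensionPast`, exports no decay at all).

## Mathlib / tree search

Reused: `exists_classical_extension_of_bounded_rep`,
`IsClassicalNSSolutionOn.exists_glue_Ico_right` (`LerayHopfClassicalContinuation`),
`IsClassicalNSSolutionOn.contDiff_velocity` / `.mono` (`ClassicalSolution`); Mathlib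
`exists_seq_tendsto_sSup`, `le_csSup`, `csSup_le`, `lt_mem_nhds`, `Continuous.ae_eq_iff_eq`.

## References

* J. C. Robinson, J. L. Rodrigo, W. Sadowski, *The Three-Dimensional Navier–Stokes Equations.
  Classical theory*, CUP (2016), Thm. 8.17 (PDF p. 131) with Thms. 6.10, 6.15, and the proof of
  Thm. 12.3 (p. 170). [RobinsonRodrigoSadowski2016]
* J. Leray, *Sur le mouvement d'un liquide visqueux emplissant l'espace*, Acta Math. 63 (1934),
  §33. [Leray1934]
-/

noncomputable section

open MeasureTheory Set Function Filter Topology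
open scoped ENNReal NNReal

namespace Literature.Analysis.FluidPDE

section Apriori

variable {ν T : ℝ} {u₀ : EuclideanSpace ℝ (Fin 3) → EuclideanSpace ℝ (Fin 3)}
  {u : ℝ → EuclideanSpace ℝ (Fin 3) → EuclideanSpace ℝ (Fin 3)}

/-- **Classical representatives of one field agree slice by slice**: if `(V₁, P₁)` and
`(V₂, P₂)` are classical on time sets `S₁ ∋ t`, `S₂ ∋ t` and `u(t) = V₁(t)`, `u(t) = V₂(t)` a.e.,
then `V₁(t) = V₂(t)` (continuous slices which agree a.e. agree). [folklore] -/
private theorem eq_slice_of_ae_rep {S₁ S₂ : Set ℝ} {ν₁ ν₂ : ℝ}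
    {f₁ f₂ V₁ V₂ : ℝ → EuclideanSpace ℝ (Fin 3) → EuclideanSpace ℝ (Fin 3)}
    {P₁ P₂ : ℝ → EuclideanSpace ℝ (Fin 3) → ℝ} (h₁ : IsClassicalNSSolutionOn S₁ ν₁ f₁ V₁ P₁)
    (h₂ : IsClassicalNSSolutionOn S₂ ν₂ f₂ V₂ P₂) {t : ℝ} (ht₁ : t ∈ S₁) (ht₂ : t ∈ S₂)
    (hr₁ : u t =ᵐ[volume] V₁ t) (hr₂ : u t =ᵐ[volume] V₂ t) : V₁ t = V₂ t :=
  (Continuous.ae_eq_iff_eq volume (h₁.contDiff_velocity ht₁).continuous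
    (h₂.contDiff_velocity ht₂).continuous).1 (hr₁.symm.trans hr₂)

/-- **Continuation of a classical representative up to a prescribed time under an a-priori
bound** (Robinson–Rodrigo–Sadowski 2016, Thm. 8.17 with Thms. 6.10, 6.15, iterated as in the
proof of Thm. 12.3; Leray 1934, §33). Let `u` be Leray–Hopf on `ℝ³ × [0, T)` (`ν > 0`), let
`(V, P)` be classical on the time set `[0, β₀)`, `0 < β₀`, with `u(t) = V(t)` a.e. for every
`t ∈ [0, β₀)`, and let `β₀ ≤ β₁ < T`. Suppose A PRIORI: every classical `(V', P')` on a time set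
`[0, β)`, `β₀ ≤ β ≤ β₁`, with `V' = V` on `[0, β₀)` and `u(t) = V'(t)` a.e. for `t ∈ [0, β)`,
satisfies `‖V'(t, x)‖ ≤ M` on `[0, β) × ℝ³`. Then there are `b > β₁` and a classical `(V', P')`
on `[0, b)` with `V' = V` on `[0, β₀)` and `u(t) = V'(t)` a.e. for every `t ∈ [0, min b T)`.
[cite: RobinsonRodrigoSadowski2016, Thm. 8.17 with Thms. 6.10, 6.15 (proof of Thm. 12.3)] -/
theorem exists_classical_extension_of_apriori_bound (hν : 0 < ν)
    (hLH : IsLerayHopfOn T ν 0 u₀ u) {β₀ β₁ : ℝ} (hβ₀ : 0 < β₀) (h01 : β₀ ≤ β₁) (hβ₁T : β₁ < T)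
    {V : ℝ → EuclideanSpace ℝ (Fin 3) → EuclideanSpace ℝ (Fin 3)}
    {P : ℝ → EuclideanSpace ℝ (Fin 3) → ℝ} (hV : IsClassicalNSSolutionOn (Ico 0 β₀) ν 0 V P)
    (hrep : ∀ t ∈ Ico 0 β₀, u t =ᵐ[volume] V t) {M : ℝ}
    (hM : ∀ β : ℝ, β₀ ≤ β → β ≤ β₁ →
      ∀ (V' : ℝ → EuclideanSpace ℝ (Fin 3) → EuclideanSpace ℝ (Fin 3))
        (P' : ℝ → EuclideanSpace ℝ (Fin 3) → ℝ),
      IsClassicalNSSolutionOn (Ico 0 β) ν 0 V' P' → (∀ t ∈ Ico 0 β₀, V' t = V t) →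
      (∀ t ∈ Ico 0 β, u t =ᵐ[volume] V' t) → ∀ t ∈ Ico 0 β, ∀ x, ‖V' t x‖ ≤ M) :
    ∃ b : ℝ, β₁ < b ∧ ∃ (V' : ℝ → EuclideanSpace ℝ (Fin 3) → EuclideanSpace ℝ (Fin 3))
      (P' : ℝ → EuclideanSpace ℝ (Fin 3) → ℝ),
      IsClassicalNSSolutionOn (Ico 0 b) ν 0 V' P' ∧ (∀ t ∈ Ico 0 β₀, V' t = V t) ∧
      ∀ t ∈ Ico 0 (min b T), u t =ᵐ[volume] V' t := by
  -- the set of reachable ends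
  set 𝒮 : Set ℝ := {β | β₀ ≤ β ∧ β ≤ β₁ ∧
    ∃ (V' : ℝ → EuclideanSpace ℝ (Fin 3) → EuclideanSpace ℝ (Fin 3))
      (P' : ℝ → EuclideanSpace ℝ (Fin 3) → ℝ),
    IsClassicalNSSolutionOn (Ico 0 β) ν 0 V' P' ∧ (∀ t ∈ Ico 0 β₀, V' t = V t) ∧
    ∀ t ∈ Ico 0 β, u t =ᵐ[volume] V' t} with h𝒮
  have h0 : β₀ ∈ 𝒮 := ⟨le_rfl, h01, V, P, hV, fun _ _ => rfl, hrep⟩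
  have hne : 𝒮.Nonempty := ⟨β₀, h0⟩
  have hbdd : BddAbove 𝒮 := ⟨β₁, fun β hβ => hβ.2.1⟩
  have hS₀ : β₀ ≤ sSup 𝒮 := le_csSup hbdd h0
  have hS₁ : sSup 𝒮 ≤ β₁ := csSup_le hne fun β hβ => hβ.2.1
  have hSpos : 0 < sSup 𝒮 := hβ₀.trans_le hS₀
  have hST : sSup 𝒮 ≤ T := hS₁.trans hβ₁T.le
  -- Step 1: the supremum is reached — glue along an increasing sequence of reachable ends
  have hreach : ∃ (v : ℝ → EuclideanSpace ℝ (Fin 3) → EuclideanSpace ℝ (Fin 3))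
      (p : ℝ → EuclideanSpace ℝ (Fin 3) → ℝ),
      IsClassicalNSSolutionOn (Ico 0 (sSup 𝒮)) ν 0 v p ∧ (∀ t ∈ Ico 0 β₀, v t = V t) ∧
      ∀ t ∈ Ico 0 (sSup 𝒮), u t =ᵐ[volume] v t := by
    obtain ⟨b, -, hbt, hbmem⟩ := exists_seq_tendsto_sSup hne hbdd
    choose Vn Pn hVn hVnV hVnrep using fun n => (hbmem n).2.2
    have hbβ : ∀ n, b n ≤ sSup 𝒮 := fun n => le_csSup hbdd (hbmem n)
    have hb : ∀ t, t < sSup 𝒮 → ∃ n, t < b n := fun t ht =>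
      (hbt.eventually (lt_mem_nhds ht)).exists
    have hagree : ∀ m n, ∀ t ∈ Ico 0 (min (b m) (b n)), Vn m t = Vn n t := by
      intro m n t ht
      have htm : t ∈ Ico 0 (b m) := ⟨ht.1, ht.2.trans_le (min_le_left _ _)⟩
      have htn : t ∈ Ico 0 (b n) := ⟨ht.1, ht.2.trans_le (min_le_right _ _)⟩
      exact eq_slice_of_ae_rep (hVn m) (hVn n) htm htn (hVnrep m t htm) (hVnrep n t htn)
    obtain ⟨v, p, hv, hvn⟩ := IsClassicalNSSolutionOn.exists_glue_Ico_right hbβ hb hVn hagree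
    refine ⟨v, p, hv, fun t ht => ?_, fun t ht => ?_⟩
    · have ht0 : t ∈ Ico 0 (b 0) := ⟨ht.1, ht.2.trans_le (hbmem 0).1⟩
      rw [hvn 0 t ht0]
      exact hVnV 0 t ht
    · obtain ⟨n, hn⟩ := hb t ht.2
      rw [hvn n t ⟨ht.1, hn⟩]
      exact hVnrep n t ⟨ht.1, hn⟩
  obtain ⟨v, p, hv, hvV, hvrep⟩ := hreach
  -- Step 2: the representative on `[0, sup)` is bounded a priori, so it continues past the sup
  have hvM : ∀ t ∈ Ico 0 (sSup 𝒮), ∀ x, ‖v t x‖ ≤ M := hM _ hS₀ hS₁ v p hv hvV hvrep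
  obtain ⟨b, hb, V', P', hV', -, hV'rep, -⟩ :=
    exists_classical_extension_of_bounded_rep hν hLH hSpos hST hv hvrep hvM
  have hβ₀bT : β₀ ≤ min b T := le_min (hS₀.trans hb.le) (h01.trans hβ₁T.le)
  -- `V'` agrees with `V` on `[0, β₀)` (both a.e. equal to `u`, continuous slices)
  have hV'V : ∀ t ∈ Ico 0 β₀, V' t = V t := fun t ht =>
    eq_slice_of_ae_rep hV' hV ⟨ht.1, ht.2.trans_le (hS₀.trans hb.le)⟩ ht
      (hV'rep t ⟨ht.1, ht.2.trans_le hβ₀bT⟩) (hrep t ht)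
  -- Step 3: the supremum is `β₁` (else the end `min (min b T) β₁` is reachable and exceeds it)
  have hSeq : sSup 𝒮 = β₁ := by
    by_contra hneq
    have hlt : sSup 𝒮 < β₁ := lt_of_le_of_ne hS₁ hneq
    have hgt : sSup 𝒮 < min (min b T) β₁ := lt_min (lt_min hb (hlt.trans hβ₁T)) hlt
    have hmem : min (min b T) β₁ ∈ 𝒮 := by
      refine ⟨hS₀.trans hgt.le, min_le_right _ _, V', P',
        hV'.mono (Ico_subset_Ico_right ((min_le_left _ _).trans (min_le_left _ _)))
          (uniqueDiffOn_Ico _ _), hV'V,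
        fun t ht => hV'rep t ⟨ht.1, ht.2.trans_le (min_le_left _ _)⟩⟩
    exact absurd (le_csSup hbdd hmem) (not_le.2 hgt)
  exact ⟨b, lt_of_eq_of_lt hSeq.symm hb, V', P', hV', hV'V, hV'rep⟩

end Apriori

end Literature.Analysis.FluidPDE

end
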